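import Summits.AtomisticToContinuum.FouriersLaw.Theses.BondHeatUncertainty
import Summits.AtomisticToContinuum.FouriersLaw.Theorems.BondHeatUncertaintySubdiffusiveBondHeatBathBondReductionTwoTime
import Summits.AtomisticToContinuum.FouriersLaw.Theorems.BondHeatUncertaintySubdiffusiveBondHeatBathBondReductionFlowLaws

/-!
# `SubdiffusiveBondHeat` / bath-bond reduction, part 4b: second moments of time integrals along the stationary flow

Helper file for crux `stmt-AtomisticToContinuum-9120` (`BondHeatUncertainty.SubdiffusiveBondHeat`), line
`bath-bond-deficit-integral`, stub `stub_bathBondReduction`. The crux's bond-heat variance is the KERNEL-LEVEL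
quantity `V_N(b,t) = 2∫₀ᵗ (t-s) C_N(b,s) ds`, `C_N(b,s) = ∫ j_b · (P_s j_b) dμ_T`; the reduction reads it
as the second moment `E_{μ_T}[(∫₀ᵗ j_b(z_s) ds)²]` of the time-integrated current along the stationary
process. This file proves that dictionary for the constructed flow `z_s = Φ_s(x, B)` of the pinned chain
started from an initial law `μ` that is INVARIANT for the constructed kernels (`μ.bind P_s = μ` for all
`s` — for the Gibbs measure this is clause (a) of `BoundaryEscapeDeficit.BoundaryKernelBasics`,
stmt-AtomisticToContinuum-12239, a hypothesis here): for observables `f, h` with `f², h² ∈ L¹(μ)`,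

  `E_{μ⊗W}[(∫₀ᵗ f(z_s) ds)(∫₀ᵗ h(z_s) ds)] = ∫₀ᵗ (t - r) (⟨f, P_r h⟩_μ + ⟨h, P_r f⟩_μ) dr`,

in particular `E[(∫₀ᵗ f(z_s) ds)²] = 2∫₀ᵗ (t-r) ⟨f, P_r f⟩_μ dr` (so `V_N(b,t) = E[(Q_t^{(b)})²]` once
(a) is available; registered sub-goal `pinnedChain_timeIntegral_sq`). Ingredients: the two-time law of
part 3, the one-time law and moments of part 4a, Fubini on `Ω × (0,t]²`, and `setIntegral_square_lag_eq`.

Nothing here closes an item.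
-/

noncomputable section

open MeasureTheory ProbabilityTheory Filter Topology Set intervalIntegral
open scoped NNReal ENNReal
open Literature.MathematicalPhysics.KineticTheory.HeatConduction Literature.Probability.Process

namespace Summit.AtomisticToContinuum.FouriersLaw.Theorems.SubdiffusiveBondHeat

open OscillatorChain

/-! ### Second moments of time integrals along the stationary flow -/

section Main

variable {ω₂ lam β γ : ℝ} (hω : 0 < ω₂) (hl : 0 ≤ lam) (hβ : 0 ≤ β) (hγ : 0 ≤ γ) (N : ℕ) (T_L T_R : ℝ)
include hω hl hβ hγ

/-- Integrability on `Ω × (0,t]²` of `(p, (s,u)) ↦ f(z_s(p)) h(z_u(p))` for `f, h ∈ L²(μ)` under an invariant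
initial law (`|fh| ≤ f² + h²` and the one-time law). [folklore] -/
theorem pinnedChain_integrable_uncurry_timeSquare_of_invariant (μ : Measure (PhaseSpace N)) [SFinite μ]
    (hinv : ∀ s : ℝ≥0, μ.bind ((pinnedChain ω₂ lam β γ).transitionKernel N T_L T_R s) = μ)
    {f h : PhaseSpace N → ℝ} (hf : Measurable f) (hh : Measurable h)
    (hf2 : Integrable (fun y => f y ^ 2) μ) (hh2 : Integrable (fun y => h y ^ 2) μ) (t : ℝ) :
    Integrable (Function.uncurry fun (p : PhaseSpace N × WienerPair) (z : ℝ × ℝ) =>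
      f ((pinnedChain ω₂ lam β γ).solMap N T_L T_R z.1 p.1 (pairPath p.2)) *
        h ((pinnedChain ω₂ lam β γ).solMap N T_L T_R z.2 p.1 (pairPath p.2)))
      ((μ.prod wienerPair).prod
        (((volume : Measure ℝ).restrict (Ioc 0 t)).prod ((volume : Measure ℝ).restrict (Ioc 0 t)))) := by
  haveI hLfin : IsFiniteMeasure ((volume : Measure ℝ).restrict (Ioc 0 t)) := by
    refine ⟨?_⟩
    rw [Measure.restrict_apply_univ]
    exact measure_Ioc_lt_top
  have hZ := pinnedChain_measurable_solMap_process hω hl hβ hγ N T_L T_R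
  set G : (PhaseSpace N × WienerPair) × (ℝ × ℝ) → ℝ := fun w =>
    f ((pinnedChain ω₂ lam β γ).solMap N T_L T_R w.2.1 w.1.1 (pairPath w.1.2)) *
      h ((pinnedChain ω₂ lam β γ).solMap N T_L T_R w.2.2 w.1.1 (pairPath w.1.2)) with hG
  have hGm : Measurable G := by
    have h1 : Measurable fun w : (PhaseSpace N × WienerPair) × (ℝ × ℝ) => (w.2.1, w.1) :=
      (measurable_fst.comp measurable_snd).prodMk measurable_fst
    have h2 : Measurable fun w : (PhaseSpace N × WienerPair) × (ℝ × ℝ) => (w.2.2, w.1) :=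
      (measurable_snd.comp measurable_snd).prodMk measurable_fst
    have hA := hf.comp (hZ.comp h1)
    have hB := hh.comp (hZ.comp h2)
    have hAB := hA.mul hB
    exact hAB
  have hCf : ∫⁻ y, ‖f y‖ₑ ^ 2 ∂μ < ∞ := by
    have h1 := hf2.hasFiniteIntegral
    unfold HasFiniteIntegral at h1
    simpa [enorm_pow] using h1
  have hCh : ∫⁻ y, ‖h y‖ₑ ^ 2 ∂μ < ∞ := by
    have h1 := hh2.hasFiniteIntegral
    unfold HasFiniteIntegral at h1
    simpa [enorm_pow] using h1
  have hGi : Integrable G ((μ.prod wienerPair).prod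
      (((volume : Measure ℝ).restrict (Ioc 0 t)).prod ((volume : Measure ℝ).restrict (Ioc 0 t)))) := by
    refine ⟨hGm.aestronglyMeasurable, ?_⟩
    unfold HasFiniteIntegral
    have h1m : Measurable fun w : (PhaseSpace N × WienerPair) × (ℝ × ℝ) =>
        ‖f ((pinnedChain ω₂ lam β γ).solMap N T_L T_R w.2.1 w.1.1 (pairPath w.1.2))‖ₑ ^ 2 := by
      have h1 : Measurable fun w : (PhaseSpace N × WienerPair) × (ℝ × ℝ) => (w.2.1, w.1) :=
        (measurable_fst.comp measurable_snd).prodMk measurable_fst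
      have hA := ((hf.comp (hZ.comp h1)).enorm.pow_const 2)
      exact hA
    have h2m : Measurable fun w : (PhaseSpace N × WienerPair) × (ℝ × ℝ) =>
        ‖h ((pinnedChain ω₂ lam β γ).solMap N T_L T_R w.2.2 w.1.1 (pairPath w.1.2))‖ₑ ^ 2 := by
      have h2 : Measurable fun w : (PhaseSpace N × WienerPair) × (ℝ × ℝ) => (w.2.2, w.1) :=
        (measurable_snd.comp measurable_snd).prodMk measurable_fst
      have hB := ((hh.comp (hZ.comp h2)).enorm.pow_const 2)
      exact hB
    calc ∫⁻ w, ‖G w‖ₑ ∂((μ.prod wienerPair).prod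
          (((volume : Measure ℝ).restrict (Ioc 0 t)).prod ((volume : Measure ℝ).restrict (Ioc 0 t))))
        ≤ ∫⁻ w, (‖f ((pinnedChain ω₂ lam β γ).solMap N T_L T_R w.2.1 w.1.1 (pairPath w.1.2))‖ₑ ^ 2 +
            ‖h ((pinnedChain ω₂ lam β γ).solMap N T_L T_R w.2.2 w.1.1 (pairPath w.1.2))‖ₑ ^ 2)
            ∂((μ.prod wienerPair).prod
              (((volume : Measure ℝ).restrict (Ioc 0 t)).prod ((volume : Measure ℝ).restrict (Ioc 0 t)))) := by
          refine lintegral_mono fun w => ?_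
          simp only [hG, enorm_mul]
          exact ennreal_mul_le_sq_add_sq _ _
      _ = (∫⁻ y, ‖f y‖ₑ ^ 2 ∂μ) * (((volume : Measure ℝ).restrict (Ioc 0 t)).prod
              ((volume : Measure ℝ).restrict (Ioc 0 t))) univ +
            (∫⁻ y, ‖h y‖ₑ ^ 2 ∂μ) * (((volume : Measure ℝ).restrict (Ioc 0 t)).prod
              ((volume : Measure ℝ).restrict (Ioc 0 t))) univ := by
          rw [lintegral_add_left h1m, lintegral_prod_symm _ h1m.aemeasurable, lintegral_prod_symm _ h2m.aemeasurable]
          congr 1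
          · rw [← lintegral_const]
            refine lintegral_congr fun z => ?_
            exact pinnedChain_lintegral_sq_solMap_of_invariant hω hl hβ hγ N T_L T_R μ hinv hf z.1
          · rw [← lintegral_const]
            refine lintegral_congr fun z => ?_
            exact pinnedChain_lintegral_sq_solMap_of_invariant hω hl hβ hγ N T_L T_R μ hinv hh z.2
      _ < ∞ := by
          refine ENNReal.add_lt_top.2 ⟨ENNReal.mul_lt_top hCf (measure_lt_top _ _),
            ENNReal.mul_lt_top hCh (measure_lt_top _ _)⟩
  exact hGi

/-- Integrability of the product of two time integrals along the stationary flow, `f, h ∈ L²(μ)`, `t ≥ 0`.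
[folklore] -/
theorem pinnedChain_integrable_intervalIntegral_mul_of_invariant (μ : Measure (PhaseSpace N)) [SFinite μ]
    (hinv : ∀ s : ℝ≥0, μ.bind ((pinnedChain ω₂ lam β γ).transitionKernel N T_L T_R s) = μ)
    {f h : PhaseSpace N → ℝ} (hf : Measurable f) (hh : Measurable h)
    (hf2 : Integrable (fun y => f y ^ 2) μ) (hh2 : Integrable (fun y => h y ^ 2) μ) {t : ℝ} (ht : 0 ≤ t) :
    Integrable (fun p : PhaseSpace N × WienerPair =>
      (∫ s in (0 : ℝ)..t, f ((pinnedChain ω₂ lam β γ).solMap N T_L T_R s p.1 (pairPath p.2))) *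
        (∫ s in (0 : ℝ)..t, h ((pinnedChain ω₂ lam β γ).solMap N T_L T_R s p.1 (pairPath p.2)))) (μ.prod wienerPair) := by
  have hGi := pinnedChain_integrable_uncurry_timeSquare_of_invariant hω hl hβ hγ N T_L T_R μ hinv hf hh hf2 hh2 t
  have h1 := hGi.integral_prod_left
  refine h1.congr (Eventually.of_forall fun p => ?_)
  simp only [Function.uncurry]
  rw [integral_of_le ht, integral_of_le ht]
  exact integral_prod_mul (μ := (volume : Measure ℝ).restrict (Ioc 0 t))
    (ν := (volume : Measure ℝ).restrict (Ioc 0 t))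
    (fun s => f ((pinnedChain ω₂ lam β γ).solMap N T_L T_R s p.1 (pairPath p.2)))
    (fun s => h ((pinnedChain ω₂ lam β γ).solMap N T_L T_R s p.1 (pairPath p.2)))

/-- **Second moments of time integrals along the stationary flow.** For the pinned chain started from an
initial law `μ` invariant for the constructed kernels (`μ.bind P_s = μ` for all `s`), observables
`f, h` with `f², h² ∈ L¹(μ)`, and `t ≥ 0`:
`E_{μ⊗W}[(∫₀ᵗ f(z_s) ds)(∫₀ᵗ h(z_s) ds)] = ∫₀ᵗ (t - r) (∫ f·(P_r h) dμ + ∫ h·(P_r f) dμ) dr`.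
With `f = h = j_b` the right-hand side is the crux's `V_N(b,t) = 2∫₀ᵗ (t-s) C_N(b,s) ds`, so this is
`V_N(b,t) = E[(∫₀ᵗ j_b(z_s) ds)²]` conditional on the invariance of the Gibbs measure (clause (a) of
`BoundaryEscapeDeficit.BoundaryKernelBasics`). [folklore] -/
theorem pinnedChain_integral_intervalIntegral_mul_of_invariant (μ : Measure (PhaseSpace N)) [SFinite μ]
    (hinv : ∀ s : ℝ≥0, μ.bind ((pinnedChain ω₂ lam β γ).transitionKernel N T_L T_R s) = μ)
    {f h : PhaseSpace N → ℝ} (hf : Measurable f) (hh : Measurable h)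
    (hf2 : Integrable (fun y => f y ^ 2) μ) (hh2 : Integrable (fun y => h y ^ 2) μ) {t : ℝ} (ht : 0 ≤ t) :
    ∫ p, (∫ s in (0 : ℝ)..t, f ((pinnedChain ω₂ lam β γ).solMap N T_L T_R s p.1 (pairPath p.2))) *
        (∫ s in (0 : ℝ)..t, h ((pinnedChain ω₂ lam β γ).solMap N T_L T_R s p.1 (pairPath p.2))) ∂(μ.prod wienerPair) =
      ∫ r in (0 : ℝ)..t, (t - r) *
        ((∫ y, f y * (∫ y', h y' ∂((pinnedChain ω₂ lam β γ).transitionKernel N T_L T_R r.toNNReal y)) ∂μ) +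
          (∫ y, h y * (∫ y', f y' ∂((pinnedChain ω₂ lam β γ).transitionKernel N T_L T_R r.toNNReal y)) ∂μ)) := by
  -- the finite measure `L = Lebesgue ↾ (0, t]`
  haveI hLfin : IsFiniteMeasure ((volume : Measure ℝ).restrict (Ioc 0 t)) := by
    refine ⟨?_⟩
    rw [Measure.restrict_apply_univ]
    exact measure_Ioc_lt_top
  -- joint measurability of the process
  have hZ := pinnedChain_measurable_solMap_process hω hl hβ hγ N T_L T_R
  -- second moments at one time
  have hF2 := fun r => pinnedChain_integrable_sq_solMap_of_invariant hω hl hβ hγ N T_L T_R μ hinv hf2 r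
  have hH2 := fun r => pinnedChain_integrable_sq_solMap_of_invariant hω hl hβ hγ N T_L T_R μ hinv hh2 r
  -- integrability of `f(z_s) h(z_u)` and the value of its integral
  have hint : ∀ s u : ℝ, Integrable (fun p : PhaseSpace N × WienerPair =>
      f ((pinnedChain ω₂ lam β γ).solMap N T_L T_R s p.1 (pairPath p.2)) *
        h ((pinnedChain ω₂ lam β γ).solMap N T_L T_R u p.1 (pairPath p.2))) (μ.prod wienerPair) := by
    intro s u
    have hm : Measurable (fun p : PhaseSpace N × WienerPair =>
        f ((pinnedChain ω₂ lam β γ).solMap N T_L T_R s p.1 (pairPath p.2)) *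
          h ((pinnedChain ω₂ lam β γ).solMap N T_L T_R u p.1 (pairPath p.2))) :=
      (hf.comp (pinnedChain_measurable_solMap_pairPath hω hl hβ hγ N T_L T_R s)).mul
        (hh.comp (pinnedChain_measurable_solMap_pairPath hω hl hβ hγ N T_L T_R u))
    refine ((hF2 s).1.add (hH2 u).1).mono' hm.aestronglyMeasurable (Eventually.of_forall fun p => ?_)
    simpa [Real.norm_eq_abs] using abs_mul_le_sq_add_sq _ _
  have hbound : ∀ s u : ℝ, |∫ p, f ((pinnedChain ω₂ lam β γ).solMap N T_L T_R s p.1 (pairPath p.2)) *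
      h ((pinnedChain ω₂ lam β γ).solMap N T_L T_R u p.1 (pairPath p.2)) ∂(μ.prod wienerPair)| ≤
      (∫ y, f y ^ 2 ∂μ) + ∫ y, h y ^ 2 ∂μ := by
    intro s u
    rw [← (hF2 s).2, ← (hH2 u).2, ← integral_add (hF2 s).1 (hH2 u).1, ← Real.norm_eq_abs]
    refine (MeasureTheory.norm_integral_le_integral_norm _).trans
      (integral_mono (hint s u).norm ((hF2 s).1.add (hH2 u).1) ?_)
    intro p
    simpa [Real.norm_eq_abs] using abs_mul_le_sq_add_sq _ _
  -- the path-space lag functions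
  set a : ℝ → ℝ := fun r => ∫ p, f ((pinnedChain ω₂ lam β γ).solMap N T_L T_R 0 p.1 (pairPath p.2)) *
    h ((pinnedChain ω₂ lam β γ).solMap N T_L T_R r p.1 (pairPath p.2)) ∂(μ.prod wienerPair) with ha
  set b : ℝ → ℝ := fun r => ∫ p, h ((pinnedChain ω₂ lam β γ).solMap N T_L T_R 0 p.1 (pairPath p.2)) *
    f ((pinnedChain ω₂ lam β γ).solMap N T_L T_R r p.1 (pairPath p.2)) ∂(μ.prod wienerPair) with hb
  have ham : Measurable a := by
    have hsm : StronglyMeasurable (Function.uncurry fun (r : ℝ) (p : PhaseSpace N × WienerPair) =>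
        f ((pinnedChain ω₂ lam β γ).solMap N T_L T_R 0 p.1 (pairPath p.2)) *
          h ((pinnedChain ω₂ lam β γ).solMap N T_L T_R r p.1 (pairPath p.2))) := by
      refine Measurable.stronglyMeasurable ?_
      have h0 : Measurable fun q : ℝ × (PhaseSpace N × WienerPair) => ((0 : ℝ), q.2) :=
        measurable_const.prodMk measurable_snd
      have hA := (hf.comp (hZ.comp h0)).mul (hh.comp hZ)
      exact hA
    exact (hsm.integral_prod_right (ν := μ.prod wienerPair)).measurable
  have hbm : Measurable b := by
    have hsm : StronglyMeasurable (Function.uncurry fun (r : ℝ) (p : PhaseSpace N × WienerPair) =>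
        h ((pinnedChain ω₂ lam β γ).solMap N T_L T_R 0 p.1 (pairPath p.2)) *
          f ((pinnedChain ω₂ lam β γ).solMap N T_L T_R r p.1 (pairPath p.2))) := by
      refine Measurable.stronglyMeasurable ?_
      have h0 : Measurable fun q : ℝ × (PhaseSpace N × WienerPair) => ((0 : ℝ), q.2) :=
        measurable_const.prodMk measurable_snd
      have hA := (hh.comp (hZ.comp h0)).mul (hf.comp hZ)
      exact hA
    exact (hsm.integral_prod_right (ν := μ.prod wienerPair)).measurable
  have hbound' : ∀ s u : ℝ, |∫ p, h ((pinnedChain ω₂ lam β γ).solMap N T_L T_R s p.1 (pairPath p.2)) *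
      f ((pinnedChain ω₂ lam β γ).solMap N T_L T_R u p.1 (pairPath p.2)) ∂(μ.prod wienerPair)| ≤
      (∫ y, f y ^ 2 ∂μ) + ∫ y, h y ^ 2 ∂μ := by
    intro s u
    have h1 := hbound u s
    have heq : ∫ p, h ((pinnedChain ω₂ lam β γ).solMap N T_L T_R s p.1 (pairPath p.2)) *
        f ((pinnedChain ω₂ lam β γ).solMap N T_L T_R u p.1 (pairPath p.2)) ∂(μ.prod wienerPair) =
        ∫ p, f ((pinnedChain ω₂ lam β γ).solMap N T_L T_R u p.1 (pairPath p.2)) *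
          h ((pinnedChain ω₂ lam β γ).solMap N T_L T_R s p.1 (pairPath p.2)) ∂(μ.prod wienerPair) :=
      integral_congr_ae (Eventually.of_forall fun p => mul_comm _ _)
    rw [heq]; exact h1
  have haB : ∀ r, |a r| ≤ (∫ y, f y ^ 2 ∂μ) + ∫ y, h y ^ 2 ∂μ := fun r => hbound 0 r
  have hbB : ∀ r, |b r| ≤ (∫ y, f y ^ 2 ∂μ) + ∫ y, h y ^ 2 ∂μ := fun r => hbound' 0 r
  -- kernel form of the lag functions on `r ≥ 0`
  have ha_eq : ∀ r : ℝ, 0 ≤ r → a r =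
      ∫ y, f y * (∫ y', h y' ∂((pinnedChain ω₂ lam β γ).transitionKernel N T_L T_R r.toNNReal y)) ∂μ := by
    intro r hr
    have h1 := pinnedChain_integral_mul_solMap_of_invariant hω hl hβ hγ N T_L T_R μ hinv hf hh hf2 hh2 le_rfl hr
    rw [sub_zero] at h1
    exact h1
  have hb_eq : ∀ r : ℝ, 0 ≤ r → b r =
      ∫ y, h y * (∫ y', f y' ∂((pinnedChain ω₂ lam β γ).transitionKernel N T_L T_R r.toNNReal y)) ∂μ := by
    intro r hr
    have h1 := pinnedChain_integral_mul_solMap_of_invariant hω hl hβ hγ N T_L T_R μ hinv hh hf hh2 hf2 le_rfl hr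
    rw [sub_zero] at h1
    exact h1
  -- Step 1: the product of time integrals as an integral over the square, path by path
  have hpt : ∀ p : PhaseSpace N × WienerPair,
      (∫ s in (0 : ℝ)..t, f ((pinnedChain ω₂ lam β γ).solMap N T_L T_R s p.1 (pairPath p.2))) *
        (∫ s in (0 : ℝ)..t, h ((pinnedChain ω₂ lam β γ).solMap N T_L T_R s p.1 (pairPath p.2))) =
      ∫ z, f ((pinnedChain ω₂ lam β γ).solMap N T_L T_R z.1 p.1 (pairPath p.2)) *
          h ((pinnedChain ω₂ lam β γ).solMap N T_L T_R z.2 p.1 (pairPath p.2))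
        ∂(((volume : Measure ℝ).restrict (Ioc 0 t)).prod ((volume : Measure ℝ).restrict (Ioc 0 t))) := by
    intro p
    rw [integral_of_le ht, integral_of_le ht]
    exact (integral_prod_mul (μ := (volume : Measure ℝ).restrict (Ioc 0 t))
      (ν := (volume : Measure ℝ).restrict (Ioc 0 t))
      (fun s => f ((pinnedChain ω₂ lam β γ).solMap N T_L T_R s p.1 (pairPath p.2)))
      (fun s => h ((pinnedChain ω₂ lam β γ).solMap N T_L T_R s p.1 (pairPath p.2)))).symm
  rw [integral_congr_ae (Eventually.of_forall hpt)]
  -- Step 2: Fubini between `Ω` and the square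
  have hGi' := pinnedChain_integrable_uncurry_timeSquare_of_invariant hω hl hβ hγ N T_L T_R μ hinv hf hh hf2 hh2 t
  rw [integral_integral_swap hGi']
  -- Step 3: the inner integral on the square is the lag function
  have hsq : ∀ z ∈ Ioc (0 : ℝ) t ×ˢ Ioc (0 : ℝ) t,
      ∫ p, f ((pinnedChain ω₂ lam β γ).solMap N T_L T_R z.1 p.1 (pairPath p.2)) *
          h ((pinnedChain ω₂ lam β γ).solMap N T_L T_R z.2 p.1 (pairPath p.2)) ∂(μ.prod wienerPair) =
        if z.1 < z.2 then a (z.2 - z.1) else b (z.1 - z.2) := by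
    intro z hz
    obtain ⟨⟨hz1, -⟩, ⟨hz2, -⟩⟩ := hz
    by_cases hlt : z.1 < z.2
    · rw [if_pos hlt, ha_eq _ (sub_nonneg.2 hlt.le)]
      exact pinnedChain_integral_mul_solMap_of_invariant hω hl hβ hγ N T_L T_R μ hinv hf hh hf2 hh2 hz1.le hlt.le
    · rw [if_neg hlt, hb_eq _ (sub_nonneg.2 (not_lt.1 hlt))]
      have heq : ∫ p, f ((pinnedChain ω₂ lam β γ).solMap N T_L T_R z.1 p.1 (pairPath p.2)) *
          h ((pinnedChain ω₂ lam β γ).solMap N T_L T_R z.2 p.1 (pairPath p.2)) ∂(μ.prod wienerPair) =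
          ∫ p, h ((pinnedChain ω₂ lam β γ).solMap N T_L T_R z.2 p.1 (pairPath p.2)) *
            f ((pinnedChain ω₂ lam β γ).solMap N T_L T_R z.1 p.1 (pairPath p.2)) ∂(μ.prod wienerPair) :=
        integral_congr_ae (Eventually.of_forall fun p => mul_comm _ _)
      rw [heq]
      exact pinnedChain_integral_mul_solMap_of_invariant hω hl hβ hγ N T_L T_R μ hinv hh hf hh2 hf2 hz2.le (not_lt.1 hlt)
  rw [Measure.prod_restrict, setIntegral_congr_fun (measurableSet_Ioc.prod measurableSet_Ioc) hsq,
    setIntegral_square_lag_eq ham hbm haB hbB ht]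
  -- Step 4: back to the kernels
  refine intervalIntegral.integral_congr fun r hr => ?_
  rw [uIcc_of_le ht] at hr
  rw [ha_eq r hr.1, hb_eq r hr.1]

/-- **`V = E[(∫₀ᵗ f(z_s) ds)²]`**: the diagonal case of
`pinnedChain_integral_intervalIntegral_mul_of_invariant`. [folklore] -/
theorem pinnedChain_integral_sq_intervalIntegral_of_invariant (μ : Measure (PhaseSpace N)) [SFinite μ]
    (hinv : ∀ s : ℝ≥0, μ.bind ((pinnedChain ω₂ lam β γ).transitionKernel N T_L T_R s) = μ)
    {f : PhaseSpace N → ℝ} (hf : Measurable f) (hf2 : Integrable (fun y => f y ^ 2) μ) {t : ℝ} (ht : 0 ≤ t) :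
    ∫ p, (∫ s in (0 : ℝ)..t, f ((pinnedChain ω₂ lam β γ).solMap N T_L T_R s p.1 (pairPath p.2))) ^ 2 ∂(μ.prod wienerPair) =
      2 * ∫ r in (0 : ℝ)..t, (t - r) *
        ∫ y, f y * (∫ y', f y' ∂((pinnedChain ω₂ lam β γ).transitionKernel N T_L T_R r.toNNReal y)) ∂μ := by
  have h1 := pinnedChain_integral_intervalIntegral_mul_of_invariant hω hl hβ hγ N T_L T_R μ hinv hf hf hf2 hf2 ht
  simp only [sq]
  rw [h1, ← intervalIntegral.integral_const_mul]
  refine intervalIntegral.integral_congr fun r _ => ?_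
  ring

end Main

/-- **Second moment of a time integral along the stationary flow** (registered sub-goal of
`stub_bathBondReduction`; closed form of `pinnedChain_integral_sq_intervalIntegral_of_invariant`): for the pinned
chain (`ω₂ > 0`, `lam, β, γ ≥ 0`), an s-finite initial law `μ` invariant for the constructed kernels,
`f` measurable with `f² ∈ L¹(μ)` and `t ≥ 0`,
`E_{μ⊗W}[(∫₀ᵗ f(z_s) ds)²] = 2∫₀ᵗ (t - r) ∫ f · (P_r f) dμ dr`. [folklore] -/
theorem pinnedChain_timeIntegral_sq :
    ∀ (ω₂ lam β γ : ℝ), 0 < ω₂ → 0 ≤ lam → 0 ≤ β → 0 ≤ γ → ∀ (N : ℕ) (T_L T_R : ℝ)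
      (μ : MeasureTheory.Measure (PhaseSpace N)) [MeasureTheory.SFinite μ],
      (∀ s : NNReal, μ.bind ((pinnedChain ω₂ lam β γ).transitionKernel N T_L T_R s) = μ) →
      ∀ (f : PhaseSpace N → ℝ), Measurable f → MeasureTheory.Integrable (fun y => f y ^ 2) μ →
      ∀ t : ℝ, 0 ≤ t →
        ∫ p, (∫ s in (0 : ℝ)..t, f ((pinnedChain ω₂ lam β γ).solMap N T_L T_R s p.1
            (Literature.Probability.Process.pairPath p.2))) ^ 2 ∂(μ.prod Literature.Probability.Process.wienerPair) =
          2 * ∫ r in (0 : ℝ)..t, (t - r) *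
            ∫ y, f y * (∫ y', f y' ∂((pinnedChain ω₂ lam β γ).transitionKernel N T_L T_R r.toNNReal y)) ∂μ := by
  intro ω₂ lam β γ hω hl hβ hγ N T_L T_R μ _ hinv f hf hf2 t ht
  exact pinnedChain_integral_sq_intervalIntegral_of_invariant hω hl hβ hγ N T_L T_R μ hinv hf hf2 ht

end Summit.AtomisticToContinuum.FouriersLaw.Theorems.SubdiffusiveBondHeat
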